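import Summits.Ventures.HodgeRepro2.T5SU11GaussLegendre
import Summits.Ventures.HodgeRepro2.T5SU11LegendreAtZero

/-!
# The Gauss–Legendre rule is symmetric: the node set is `−s = s` and `w_{−x} = w_x`

The zero set `s` of `P_n` is symmetric under `x ↦ −x` (row 400, `legP_neg_eq_zero_iff`): `s.image (−·) = s`
(`image_neg_eq_self`). For a symmetric node set the Lagrange basis transforms as `ℓ_{−i}(−x) = ℓ_i(x)` — each factor
`(x − j)/(i − j)` of `ℓ_i` becomes `(−x + j)/(−i + j)` under `i ↦ −i`, `j ↦ −j`, `x ↦ −x` — i.e. as polynomials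
`ℓ_{−i} ∘ (−X) = ℓ_i` (`basis_neg_comp_neg`, from `Lagrange.basis = ∏ basisDivisor` and `Finset.prod_image`), so by
`∫_{−1}^{1} f(−x) dx = ∫_{−1}^{1} f(x) dx`:

  **`w_{−i} = w_i`** for every node `i`   (`weight_neg`),

and the rule pairs the nodes `±x_i` with equal weights; the node `0` is present exactly when `n` is odd (row 396's
`P_{2m+1}(0) = 0`, `P_{2m}(0) ≠ 0`: `zero_mem_iff_odd`). Nothing is claimed about (N).

Blind lane: Mathlib + the HodgeRepro2 prefix only; no sorry; axioms ⊆ {propext, Classical.choice,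
Quot.sound}.
-/

namespace Summit.Ventures.HodgeRepro2.T5SU11GaussLegendreSymmetry

open Polynomial intervalIntegral Finset Set
open T5SU11SphericalLegendreAll T5SU11SphericalLegendreLaplace T5SU11LegendreZeros T5SU11GaussLegendre

/-! ### The node set is symmetric -/

/-- **The zero set of `P_n` is symmetric**: `s.image (−·) = s` for the `n`-element zero set `s`. -/
theorem image_neg_eq_self {n : ℕ} {s : Finset ℝ} (hcard : s.card = n) (hs : ∀ r ∈ s, legP n r = 0) :
    s.image (fun x : ℝ => -x) = s := by
  have hiff := legP_eq_zero_iff n hcard hs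
  ext x
  simp only [Finset.mem_image]
  constructor
  · rintro ⟨y, hy, rfl⟩
    rw [← hiff, legP_neg_eq_zero_iff]
    exact (hiff y).mpr hy
  · intro hx
    refine ⟨-x, ?_, neg_neg x⟩
    rw [← hiff, legP_neg_eq_zero_iff]
    exact (hiff x).mpr hx

/-- `−i ∈ s` for `i ∈ s` (symmetric node set). -/
theorem neg_mem {s : Finset ℝ} (hsym : s.image (fun x : ℝ => -x) = s) {i : ℝ} (hi : i ∈ s) : -i ∈ s := by
  rw [← hsym]
  exact Finset.mem_image_of_mem _ hi

/-! ### The Lagrange basis under `x ↦ −x` -/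

/-- `basisDivisor (−i) (−j) ∘ (−X) = basisDivisor i j`. -/
theorem basisDivisor_neg_comp_neg (i j : ℝ) :
    (Lagrange.basisDivisor (-i) (-j)).comp (-X) = Lagrange.basisDivisor i j := by
  rw [Lagrange.basisDivisor, Lagrange.basisDivisor, mul_comp, C_comp, sub_comp, X_comp, C_comp]
  have : (-i - -j)⁻¹ = -(i - j)⁻¹ := by rw [show -i - -j = -(i - j) by ring, inv_neg]
  rw [this]
  simp only [map_neg]
  ring

/-- **`ℓ_{−i} ∘ (−X) = ℓ_i`** for a symmetric node set. -/
theorem basis_neg_comp_neg {s : Finset ℝ} (hsym : s.image (fun x : ℝ => -x) = s) (i : ℝ) :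
    (Lagrange.basis s id (-i)).comp (-X) = Lagrange.basis s id i := by
  have hinj : Function.Injective (fun x : ℝ => -x) := neg_injective
  rw [Lagrange.basis, Lagrange.basis, Polynomial.prod_comp]
  -- re-index the product over `s.erase (−i) = (s.erase i).image (−·)`
  have herase : s.erase (-i) = (s.erase i).image (fun x : ℝ => -x) := by
    rw [Finset.image_erase hinj, hsym]
  rw [herase, Finset.prod_image fun x _ y _ h => hinj h]
  refine Finset.prod_congr rfl fun j _ => ?_
  simp only [id]
  exact basisDivisor_neg_comp_neg i j

/-- `ℓ_{−i}(−x) = ℓ_i(x)`. -/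
theorem eval_basis_neg_neg {s : Finset ℝ} (hsym : s.image (fun x : ℝ => -x) = s) (i x : ℝ) :
    (Lagrange.basis s id (-i)).eval (-x) = (Lagrange.basis s id i).eval x := by
  have h := congrArg (fun p : ℝ[X] => p.eval x) (basis_neg_comp_neg hsym i)
  simp only [eval_comp, eval_neg, eval_X] at h
  exact h

/-! ### The weights are symmetric -/

/-- **`w_{−i} = w_i`** for a symmetric node set. -/
theorem weight_neg {s : Finset ℝ} (hsym : s.image (fun x : ℝ => -x) = s) (i : ℝ) :
    weight s (-i) = weight s i := by
  rw [weight, weight]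
  have h : (∫ x in (-1 : ℝ)..1, (Lagrange.basis s id (-i)).eval (-x))
      = ∫ x in (-(1 : ℝ))..(-(-1 : ℝ)), (Lagrange.basis s id (-i)).eval x :=
    integral_comp_neg (f := fun y => (Lagrange.basis s id (-i)).eval y)
  rw [neg_neg] at h
  rw [← h]
  exact integral_congr fun x _ => eval_basis_neg_neg hsym i x

/-- **The Gauss–Legendre rule is symmetric**: for the zero set `s` of `P_n`, `−s = s` and `w_{−x_i} = w_{x_i}`. -/
theorem gauss_legendre_symmetric {n : ℕ} {s : Finset ℝ} (hcard : s.card = n) (hs : ∀ r ∈ s, legP n r = 0) :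
    s.image (fun x : ℝ => -x) = s ∧ ∀ i ∈ s, weight s (-i) = weight s i :=
  ⟨image_neg_eq_self hcard hs, fun i _ => weight_neg (image_neg_eq_self hcard hs) i⟩

/-- **`0` is a node iff `n` is odd** (row 396: `P_{2m+1}(0) = 0`, `P_{2m}(0) = (−1)^m C(2m,m)/4^m ≠ 0`). -/
theorem zero_mem_iff_odd {n : ℕ} {s : Finset ℝ} (hcard : s.card = n) (hs : ∀ r ∈ s, legP n r = 0) :
    (0 : ℝ) ∈ s ↔ Odd n := by
  rw [← legP_eq_zero_iff n hcard hs]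
  rcases Nat.even_or_odd' n with ⟨m, rfl | rfl⟩
  · have h := (T5SU11LegendreAtZero.legP_zero_pair m).1
    rw [h]
    constructor
    · intro h0
      exfalso
      have : T5SU11LegendreHeine.binomHalf m ≠ 0 := (T5SU11LegendreHeine.binomHalf_pos m).ne'
      exact this (by
        rcases mul_eq_zero.mp h0 with h1 | h1
        · exact absurd h1 (pow_ne_zero m (by norm_num))
        · exact h1)
    · intro hodd
      exact absurd hodd (by rw [Nat.not_odd_iff_even]; exact ⟨m, by ring⟩)
  · have h := (T5SU11LegendreAtZero.legP_zero_pair m).2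
    rw [h]
    exact ⟨fun _ => ⟨m, rfl⟩, fun _ => rfl⟩

end Summit.Ventures.HodgeRepro2.T5SU11GaussLegendreSymmetry
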